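import Summits.AtomisticToContinuum.Crystallization.Theorems.OverbindingBudgetAffineFarSmoothSplit

/-!
# OverbindingBudget — the sheltered registration crux Zr‴ split: FAR CHARTING (Zr‴a, geometric) + NORMAL CORE PRICING (Zr‴b, energetic), PROVED glue
# (decomp-a2c lens-4, generation 48; optional second layer under `ShelteredCoreRegistration`; lands only after `…OverbindingBudgetAffineFarSmoothSplit`)

Zr‴ `ShelteredCoreRegistration θ θ₀` asks, at every SHELTERED normal far site, for an exact admissible Barlow chart that is pattern-far and whose
reference core prices the actual smooth core.  The two demands are of different nature and are cut apart here:

* **Zr‴a `ShelteredFarCharting θ θ₀`** (GEOMETRIC; the registration content).  R_aff ⇒ for every frame tolerance `τ > 0` there are a shelter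
  radius `R ≥ 0`, an exactness constant `C ≥ 0` and `ε_A > 0` such that, for `ε₁ ≤ ε_A` and every window, every site of the SHELTERED NORMAL
  FAR CLASS `shelteredFarSet R θ₀ 12 ε₁ θ δ y` (good, not scale-bad — hence genuinely `θ₀`-far-framed: `farSet` also holds the near-framed scale-bad
  sites, which are NOT pattern-far — and `R`-sheltered: every site within `R·nn_i` is good) carries a chart `c` with `IsChart C ε₁ y i c`,
  `ChartAdmissible θ c` and `PatternFar θ₀ τ c`.  WHY TRUE (all tools in the tree): shelter ⇒ every site within `R·nn_i` is good, hence `AffReg`, so R_aff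
  (`AffineChartStraightening`, at `ρ := R`) straightens the ball: common linear part `B` (`3θ`-near a linear isometry), scale `a₀`, positions `z`
  (`C_R ε₁ nn_i`-near `y`) that are EXACTLY locally close-packed (`z k − z j ∈ a₀·B(A_j P_j)`, every pattern point realised).  After `B⁻¹` and
  the rescaling `2/a₀` the straightened ball is a unit-ball packing with Hales's separation (distances `2` or `≥ 2√2 > 2·hales_h0`) all of whose
  kissing shells are `IsArrangedIn … fccKissingPattern ∨ … hcpKissingPattern` (`fccKissingPattern_subset`, `hcpKissingPattern_subset`:
  Literature `TwoShellPatterns`), so the PROVED exact local layer-stacking theorem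
  `Summit.AtomisticToContinuum.Crystallization.Theorems.ball_barlow` (file `BrittleRungDescentSoftLayerPropagation.lean`; Hales DSP §1.3, cases F
  and H) puts the centres within `R'` in an isometric image `g` of `barlowStacking 2 (2√(2/3)) s`, `IsHaggSeq s`.  Unwinding (`s` re-indexed at the
  layer of `i`, linear part `B ∘ L`, scale `a₀`) gives the chart; `IsChart` with constant `2 C_R` (structure points ARE the straightened sites; the
  converse clause by walking contact steps from `i`, each occupied point having its twelve stacking neighbours occupied); admissibility: `IsHaggSeq`,
  `B ∘ L` is `3θ`-near the isometry `Q₀ ∘ L`, the `nn`-clauses from the stacking norms (`…BarlowNorm`), summability from `…BarlowSum`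
  (`θ ≤ 1/18`); `PatternFar θ₀ τ c` with `A₀ :=` the site's OWN far `ε₁`-frame `A₁` (far: every `Q` has a `v ∈ P` with `θ₀ < ‖A₁ v − Q v‖`, else
  `(Q, A₁, P, f)` would witness `AffFramed ε₁ θ₀`), `π v :=` the structure point of the site `f v` (a two-shell point of norm `‖v‖ ≤ √2 ≤ 3/2` by
  R_aff's pattern clause), `τ`-close once `ε_A ≤ τ/(3C + 3)`.  (The crossing-fault configurations of critic row 775 are exactly the unsheltered
  case: two `h`-plane families through one ball force a non-`AffReg` site on their crossing line, hence a non-good site within `≈ 8·nn`.)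
  Difficulty M (bookkeeping over named theorems); potential-free except the summability clause of `ChartAdmissible`.
* **Zr‴b `NormalCorePricing θ`** (ENERGETIC, routine).  For every exactness constant `C ≥ 0` there are `C₂ ≥ 0` and `ε_E > 0` such that for
  `ε₁ ≤ ε_E`, every window, every NORMAL good site `i` (good, not scale-bad) and EVERY chart `c` with `IsChart C ε₁ y i c ∧ ChartAdmissible θ c`:
  `refEnergy c − refTail c − C₂ ε₁ ≤ smoothCore G y i`.  WHY TRUE: both sides are finite sums of `(1 − tailW)·V` over the core support
  `r ≤ 44/5·nn`; `IsChart` matches structure points with `a₀‖B p‖ ≤ 9 nn_i` and sites within `9 nn_i` bijectively up to `C ε₁ nn_i` (separation on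
  both sides); matched GOOD sites contribute Lipschitz errors `O(ε₁)` (normal scale: `nn_i ≥ 122/125·(1 − …)` keeps `V`, `tailW` uniformly Lipschitz
  on the support; `|c.nn − nn_i| ≤ C ε₁ nn_i` handles the weight's scale argument); a structure point matched to a NON-good site has reference term
  `(1 − tailW)·V(a₀‖B p‖) ≤ 0` because `a₀‖B p‖ ≥ c.nn ≥ (1 − Cε₁) nn_i > 2^{-1/6}` (the zero of `lennardJones`) at a normal site — dropping it
  from the actual side only helps.  No shelter, no R_aff, no `θ₀` needed.  Difficulty S.
* **Glue (PROVED)** `shelteredCoreRegistration_of_charting_pricing : ShelteredFarCharting θ θ₀ → NormalCorePricing θ → ShelteredCoreRegistration θ θ₀`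
  (take Zr‴a's `R, C, ε_A`, then Zr‴b's `C₂, ε_E` at that `C`; `ε := min ε_A ε_E`; a site of `shelteredFarSet R …` is good and normal by
  `mem_shelteredFarSet` and `farSet_subset_goodSet`) and the record corollary at `(θ, θ₀) = (1/25, 1/2000)`.
  The converse `IsChart` clause in Zr‴a (every structure point inside the ball is occupied) is the descent «nearest unoccupied stacking point»:
  by `exists_mem_kissingShell_norm_add_sub_sq_le` (same tree file) a stacking point farther than `√2` from the centre has a stacking neighbour
  strictly closer, which is occupied by minimality, and an occupied point's twelve stacking neighbours are its twelve straightened sites.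
No `sorry`, no new axioms, no `instance`, no new notation (the parent files' `local notation "E3"` only).
-/

namespace Summit.AtomisticToContinuum.Crystallization.Theorems.OverbindingBudgetAffineFarSmoothSplit

open scoped BigOperators Classical
open Literature.MathematicalPhysics.StatisticalMechanics
open Literature.Geometry.DiscreteGeometry (nearestDist nearestDist_nonneg fccTwoShellPattern hcpTwoShellPattern)
open Summit.AtomisticToContinuum.Crystallization.Theorems.OverbindingBudgetBalancedCensusStatements
open Summit.AtomisticToContinuum.Crystallization.Theorems.OverbindingBudgetAffineLadder
open Summit.AtomisticToContinuum.Crystallization.Theorems.OverbindingBudgetAffineLocalisation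

variable {N : ℕ}

local notation "E3" => EuclideanSpace ℝ (Fin 3)

/-- **Zr‴a · `ShelteredFarCharting θ θ₀`** (NEW second-layer item · TRUE-type · ATTACKABLE-M, all tools in the tree): R_aff ⇒ for every frame
tolerance `τ > 0` some shelter radius `R ≥ 0`, exactness constant `C ≥ 0` and `ε_A > 0` such that for `ε₁ ≤ ε_A`, every window `[δ, 2]`, every
injective configuration and every site `i` of the sheltered normal far class `shelteredFarSet R θ₀ 12 ε₁ θ δ y` (the class of Zr‴ itself), there is
a chart `c` with `IsChart C ε₁ y i c`, `ChartAdmissible θ c` and `PatternFar θ₀ τ c` (no energy inequality).  Route: shelter ⇒ `AffReg` on the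
`R`-ball ⇒ R_aff straightening ⇒ the PROVED exact local layer-stacking theorem
`Summit.AtomisticToContinuum.Crystallization.Theorems.ball_barlow` on the straightened, `B⁻¹`-normalised, `2/a₀`-rescaled ball (kissing shells arranged
by `fccKissingPattern_subset` / `hcpKissingPattern_subset`) ⇒ Barlow chart; admissibility via `…BarlowNorm` / `…BarlowSum`; `PatternFar` from the site's
own far `ε₁`-frame (module docstring).  Why it might fail: only a gap in the bookkeeping dictionary (scale `2 ↔ 1`, re-indexing the Hägg sequence at
the layer of `i`, the converse `IsChart` clause by contact-step walking) — no mathematical obstruction is known; the crossing-fault configurations of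
critic row 775 are unsheltered. -/
def ShelteredFarCharting (θ θ₀ : ℝ) : Prop :=
  AffineChartStraightening → ∀ τ : ℝ, 0 < τ →
    ∃ R C εA : ℝ, 0 ≤ R ∧ 0 ≤ C ∧ 0 < εA ∧ ∀ ε₁ : ℝ, 0 < ε₁ → ε₁ ≤ εA → ∀ δ : ℝ, 0 < δ → δ ≤ 2 →
      ∀ (N : ℕ) (y : Fin N → E3), Function.Injective y →
        ∀ i ∈ shelteredFarSet R θ₀ 12 ε₁ θ δ y,
          ∃ c : Chart, IsChart C ε₁ y i c ∧ ChartAdmissible θ c ∧ PatternFar θ₀ τ c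

/-- **Zr‴b · `NormalCorePricing θ`** (NEW second-layer item · TRUE-type · ATTACKABLE-S): for every exactness constant `C ≥ 0` some `C₂ ≥ 0` and
`ε_E > 0` such that for `ε₁ ≤ ε_E`, every window, every injective configuration, every NORMAL good site `i` (good and not scale-bad) and EVERY chart
`c` that is `C ε₁`-exact at `i` and `θ`-admissible, the chart's reference core prices the actual smooth core:
`refEnergy c − refTail c − C₂ ε₁ ≤ smoothCore G y i`.  Finite sums over the core support `r ≤ 44/5·nn`, matched bijectively by `IsChart` up to
`C ε₁ nn_i`; matched good sites give Lipschitz errors `O(ε₁)` (normal scale keeps the Lipschitz constants uniform); a structure point matched to a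
non-good site has a NON-POSITIVE reference term (`a₀‖B p‖ ≥ c.nn ≥ (1 − C ε₁) nn_i > 2^{-1/6}`), so omitting it from `smoothCore G` only helps.  No
shelter, no R_aff, no `θ₀`.  Why it might fail: it does not, short of a slip in the normal-scale window (`122/125`) versus the zero `2^{-1/6}` of
`lennardJones` — margin `0.976·(1 − Cε₁) > 0.891`. -/
def NormalCorePricing (θ : ℝ) : Prop :=
  ∀ C : ℝ, 0 ≤ C → ∃ C₂ εE : ℝ, 0 ≤ C₂ ∧ 0 < εE ∧ ∀ ε₁ : ℝ, 0 < ε₁ → ε₁ ≤ εE → ∀ δ : ℝ, 0 < δ → δ ≤ 2 →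
    ∀ (N : ℕ) (y : Fin N → E3), Function.Injective y →
      ∀ i ∈ goodSet 12 ε₁ θ δ y, i ∉ goodScaleBadSet 12 ε₁ θ δ y →
        ∀ c : Chart, IsChart C ε₁ y i c → ChartAdmissible θ c →
          refEnergy c - refTail c - C₂ * ε₁ ≤ smoothCore (goodSet 12 ε₁ θ δ y) y i

/-- **GLUE (PROVED): far charting + normal core pricing ⇒ the sheltered registration crux Zr‴.** [this file] -/
theorem shelteredCoreRegistration_of_charting_pricing {θ θ₀ : ℝ} (ha : ShelteredFarCharting θ θ₀) (hb : NormalCorePricing θ) :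
    ShelteredCoreRegistration θ θ₀ := by
  intro hR τ hτ
  obtain ⟨R, C, εA, hR0, hC, hεA, hA⟩ := ha hR τ hτ
  obtain ⟨C₂, εE, hC₂, hεE, hB⟩ := hb C hC
  refine ⟨R, C, C₂, min εA εE, hR0, hC, hC₂, lt_min hεA hεE, fun ε₁ hε₁ hε₁le δ hδ hδ2 N y hy i hi => ?_⟩
  obtain ⟨⟨hfar, hnsb⟩, -⟩ := mem_shelteredFarSet.mp hi
  obtain ⟨c, hc, hadm, hpf⟩ := hA ε₁ hε₁ (hε₁le.trans (min_le_left _ _)) δ hδ hδ2 N y hy i hi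
  exact ⟨c, hc, hadm, hpf, hB ε₁ hε₁ (hε₁le.trans (min_le_right _ _)) δ hδ hδ2 N y hy i
    (farSet_subset_goodSet θ₀ 12 ε₁ θ δ y hfar) hnsb c hc hadm⟩

/-- Record literals: `ShelteredFarCharting (1/25) (1/2000) → NormalCorePricing (1/25) → ShelteredCoreRegistration (1/25) (1/2000)`. [this file] -/
theorem shelteredCoreRegistration_record_of_charting_pricing (ha : ShelteredFarCharting (1 / 25) (1 / 2000))
    (hb : NormalCorePricing (1 / 25)) : ShelteredCoreRegistration (1 / 25) (1 / 2000) :=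
  shelteredCoreRegistration_of_charting_pricing ha hb

end Summit.AtomisticToContinuum.Crystallization.Theorems.OverbindingBudgetAffineFarSmoothSplit
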